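import Mathlib

/-!
# Venture AbcShadow — SH-04 STATEMENT ([BD10] closure): `x⁵ + y⁵ = 13 z¹¹` has no non-trivial primitive solution

HONEST FRAMING. Statement file of the work-bound cell `abc-shadow` (row SH-04 of its census, sub-row "[BD10] `(d, p) = (13, 11)`
closed"; typer seat `abc-shadow-typ-1`, lineage g2). This file PROVES NOTHING about the equation: it types the TARGET as a plain
`Prop` (`SH04BD13_11`) with EXACTLY the printed conventions of [BD10] = N. Billerey, L. V. Dieulefait, "Solving Fermat-type
equations `x⁵ + y⁵ = dz^p`", Math. Comp. 79 (2010) 535–544, §1 p. 1: "a solution `(a,b,c)` of the equation `x⁵+y⁵=dz^p` is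
primitive if `(a,b)=1` and non-trivial if `c ≠ 0` (note that this is not the same definition as in [Bil07])". IN PRINT:
[BD10, Thm 3.3] "The equation `x⁵+y⁵=13z^p` does not have non-trivial primitive solutions for `p ≥ 19`"; the exponent `p = 11`
typed here is OUTSIDE the printed range (`sh04BD13_11_outside_print`) — it is the cell's computed closure (certificate
4a36c28685fe0350 part D: every newform orbit of levels 650, 2600, 5200 excluded at `p = 11`). ADJACENT result (generalized
Fermat, signature `(5, 5, p)`), NOT abc: nothing here is a claim on the abc conjecture or on any summit, and nothing here takes a
side on IUT. The conditional derivation (typed/kernel-checked REDUCTION to the named [BD10]/[Bil07] inputs + the COMPUTED newform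
data entering as `DataComplete`) is `SH04/RowBD13_11.lean`.
-/

namespace Summit.Ventures.AbcShadow

/-- **SH-04, [BD10] pair `(d, p) = (13, 11)`** (census row of the cell `abc-shadow`): the equation `x⁵ + y⁵ = 13 z¹¹` has NO
solution in integers `x, y, z` with `(x, y) = 1` ("primitive") and `z ≠ 0` ("non-trivial") — [BD10, Thm 3.3]'s conclusion at
the exponent `p = 11`, which print (`p ≥ 19`) does not cover. Plain `Prop`; nothing is asserted here. ADJACENT, NOT abc.
[cite: BillereyDieulefait2010, Thm 3.3 and §1 p.1 (conventions; the exponent 11 is outside the printed range p ≥ 19)] -/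
def SH04BD13_11 : Prop :=
  ∀ x y z : ℤ, IsCoprime x y → z ≠ 0 → x ^ 5 + y ^ 5 ≠ 13 * z ^ 11

/-- Bookkeeping [cite: BillereyDieulefait2010, Thm 3.3]: the printed range is `p ≥ 19`; the exponent `11` is a prime `≥ 7`
(the standing range of [BD10, §1]) below it, and `11 ≠ 13` (so [Bil07] gives weight 2, as used in [BD10, §3.3]). -/
theorem sh04BD13_11_outside_print : Nat.Prime 11 ∧ 7 ≤ 11 ∧ 11 < 19 ∧ (11 : ℕ) ≠ 13 := by
  refine ⟨by norm_num, by norm_num, by norm_num, by norm_num⟩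

end Summit.Ventures.AbcShadow
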